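import Summits.QuantumFields.BalabanUV.Beta.EriceRemainderEnclosureHistoryAutonomyComparisonAgeCompositionInduction
import Summits.QuantumFields.BalabanUV.Beta.EriceRemainderEnclosureHistoryAutonomyComparisonAgeCompositionHarnack
import Summits.QuantumFields.BalabanUV.Beta.EriceRemainderEnclosureHistoryAutonomyComparisonAgeCompositionSandwich

/-!
# EriceRemainderEnclosureHistoryAutonomyComparisonAgeCompositionChainWiring — (E80d) THE SANDWICH WIRING OF ROUTE (N): a joint downward induction over the
# ages carrying POSITIVITY of the surplus AND the DROP RATIOS at every pin, driven by the static chain — so that **«the static chain closes at every pin»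
# ∧ MONO ∧ MONO′ ⟹ the first-order comparison surplus of the whole profile is non-negative** ((E71b)'s END with KEY derived instead of assumed)

Cell `pub-balaban`, β-function sub-cell, BINDER row D4 «RemainderConst leaves for Bałaban's split» (`HOME/BINDER-OWNERS.md`; owner lineage `b2b-balaban-beta-an4`;
this file by co-owner #2 lineage `b2b-balaban-beta-d4-p2`, generation 71), β-FLOW TEAM duty (1), FREEZE (0) honoured (def-free; imports (E71b)
`…AgeCompositionInduction` (hence (E71a)), (E71c) `…AgeCompositionHarnack`, (E71d) `…AgeCompositionSandwich`; nothing restated).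

HONEST FRAMING (page 1, verbatim and binding).  *"Discharging BetaPertH makes Bałaban's UV stability UNCONDITIONAL — a real constructive-QFT result; it is
NOT the continuum limit and NOT the Clay problem."*  THIS FILE DISCHARGES NOTHING OF THE KIND.  Elementary linear algebra about ABSTRACT real sequences, triangular
read∕solution operators and finite sums — hypotheses of a census, not facts; the age profile of Bałaban's (1.22) limit functional is NOT PRINTED ([I] p. 298;
GAPS G-t4-U2-1∕-2) and NOT asserted.  Row D4 class UNCHANGED (critical-path width 0; instance 0∕1; D4 DISCHARGE NO DATE).  HONEST DEPENDENCY: continuum YM on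
T⁴ ⇐ BetaPertH ∧ nine spine estimates (0/9 proved); BetaPertH ⇐ (D1) ∧ (D4) ∧ CAP+tail; G-an2-4 gates asym, D1 and NE2/3/4.

THE POINT (census sense (α); route (N) of README `g62/e71` §PS; this station `HOME/b2b-balaban-beta-d4-p2/g71/e80/README.md`).  (E71b) `nonneg_of_key_mono_all_ages`:
first-order (E58′) ⟸ KEY_i ∧ MONO_i at every age; (E71c): KEY at a pin ⟸ a window Harnack bound whose load needs the DROP-TO-SURPLUS RATIOS of the older ages;
(E71d): those ratios are what the STATIC CHAIN carries (`β ↦ β∕(1−ρ)`, `β_young = ρ∕(1−ρ)`), by the surplus sandwich (MONO′).  The READMEs since g62 state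
«modulo MONO∕MONO′, the static chain closes at every pin ⟹ KEY at every age ⟹ (E58′) at first order»; (E80b)∕(E80c) made the premise a theorem (over the
level-coupled system; for every box solution).  THIS FILE IS THE IMPLICATION, in (E71b)'s operator letters.  §1: the aggregate of the ages `> i` as the
indicator-weighted older system of (E71c) (`aggregate_eq_sum`, `older_read_eq`, `older_load_eq`, `older_window_mass_eq`).  §2 **`key_ratio_of_drop_ratios`**:
at one pin, drop bounds `RL k v m ≤ β_k v m` for the older ages + persistence + `Ω < 1` give the window bound `(1−Ω)v(m+l) ≤ (1+V)v m` (`V = Σθβ`) and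
**KEY WITH THE RATIO `ρ = x̃(1+V)∕(1−Ω)`** — the chain's ratio IS the KEY ratio ((E71c) `window_max_le`).  §3 **`nonneg_and_drop_ratio_all_ages`**: the joint
downward induction over the ages carrying [carried ratios `≥ 0`] ∧ [surplus `SA i w ≥ 0`] ∧ [`RL k (SA i w) m ≤ β_i(m,k)·(SA i w) m` for every pin `m` and age
`k ∈ [i,n]`], for every admissible input `w`: KEY_i with ratio from §2 and the level-`(i+1)` drop bounds; positivity by (E71a) `nonneg_of_age_composition_antitone`
(MONO_i); sandwich `(1−ρ_i(m))v ≤ ε ≤ v` by (E71d) `surplus_sandwich` (MONO′_i); transport by (E71d) `drop_ratio_step` — the older ages through the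
monotonicity of their reads, the young age through its own KEY ratio.  **`nonneg_of_chain_closes`**: THE END — static chain closes at every pin (`ρ_i(m) < 1`,
`Ω_i(m) < 1`) ∧ MONO ∧ MONO′ ⟹ `ε ≥ 0` for the full first-order system.  WHAT REMAINS for the flow: instantiate `KL`, `SL∕SA`, `θ`, `y` with the flow's
first-order objects ((E75a)∕(E75b) letters; (E64e)∕(E70e) identifications) and feed `hclose`∕`hΩ1` from (E80c) — bookkeeping; and MONO∕MONO′ themselves (OPEN since
g62, 0 violations numerically); then the nonlinear route (N).  NOT CLAIMED: MONO∕MONO′; (E58′) for the flow; anything nonlinear; anything printed.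

WHAT IS PROVED ([folklore]; 0 `def`, 0 sorry).  §1 `aggregate_eq_sum`, `older_read_eq`, `older_load_eq`, `older_window_mass_eq`.  §2 **`key_ratio_of_drop_ratios`**.
§3 **`nonneg_and_drop_ratio_all_ages`**, **`nonneg_of_chain_closes`**.
-/
noncomputable section
open Finset

namespace Summit.QuantumFields.BalabanUV.Beta.EriceRemainderEnclosureHistoryAutonomyComparisonAgeCompositionChainWiring

open Summit.QuantumFields.BalabanUV.Beta.EriceRemainderEnclosureHistoryAutonomyComparisonAgeComposition
open Summit.QuantumFields.BalabanUV.Beta.EriceRemainderEnclosureHistoryAutonomyComparisonAgeCompositionInduction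
open Summit.QuantumFields.BalabanUV.Beta.EriceRemainderEnclosureHistoryAutonomyComparisonAgeCompositionHarnack
open Summit.QuantumFields.BalabanUV.Beta.EriceRemainderEnclosureHistoryAutonomyComparisonAgeCompositionSandwich

variable {N n : ℕ} {KL KA : ℕ → ℕ → ℕ → ℝ} {RL RA SL SA : ℕ → (ℕ → ℝ) → ℕ → ℝ} {y : ℕ → ℕ} {θ : ℕ → ℕ → ℕ → ℝ}

/-! ## §1 The aggregate of the older ages as a sum of lone kernels -/

/-- `KA i = Σ_{k ∈ [i, n]} KL k` for `i ≤ n + 1` (kernel additivity, downward from the empty top). [folklore] -/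
theorem aggregate_eq_sum (hKA : ∀ i m l, KA i m l = KL i m l + KA (i + 1) m l) (hKAtop : ∀ m l, KA (n + 1) m l = 0)
    {i : ℕ} (hi : i ≤ n + 1) (m l : ℕ) : KA i m l = ∑ k ∈ Ico i (n + 1), KL k m l := by
  obtain ⟨d, hd, rfl⟩ : ∃ d, d ≤ n + 1 ∧ i = n + 1 - d := ⟨n + 1 - i, by omega, by omega⟩
  have key : ∀ d, d ≤ n + 1 → KA (n + 1 - d) m l = ∑ k ∈ Ico (n + 1 - d) (n + 1), KL k m l := by
    intro d
    induction d with
    | zero => intro _; simp [hKAtop]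
    | succ d ih =>
      intro hd
      rw [hKA, show n + 1 - (d + 1) + 1 = n + 1 - d by omega, ih (by omega),
        sum_eq_sum_Ico_succ_bot (show n + 1 - (d + 1) < n + 1 by omega),
        show n + 1 - (d + 1) + 1 = n + 1 - d by omega]
  exact key d hd

/-- The read of the ages OLDER than `i`, as the indicator-weighted double sum (E71c) `window_max_le` expects:
`RA (i+1) v m = Σ_{k < n+1} Σ_{l<N} [i<k]·KL k m l·v(m+1+l)`. [folklore] -/
theorem older_read_eq (hRA : ∀ i v m, RA i v m = ∑ l ∈ range N, KA i m l * v (m + 1 + l))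
    (hKA : ∀ i m l, KA i m l = KL i m l + KA (i + 1) m l) (hKAtop : ∀ m l, KA (n + 1) m l = 0)
    {i : ℕ} (hi : i ≤ n) (v : ℕ → ℝ) (m : ℕ) :
    RA (i + 1) v m = ∑ k ∈ range (n + 1), ∑ l ∈ range N, (if i < k then KL k m l else 0) * v (m + 1 + l) := by
  rw [hRA, sum_comm]
  refine sum_congr rfl fun l _ => ?_
  rw [aggregate_eq_sum hKA hKAtop (by omega), sum_mul]
  rw [← sum_filter_add_sum_filter_not (range (n + 1)) (fun k => i < k)]
  have hzero : ∑ k ∈ (range (n + 1)).filter (fun k => ¬ i < k), (if i < k then KL k m l else 0) * v (m + 1 + l) = 0 :=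
    sum_eq_zero fun k hk => by rw [mem_filter] at hk; rw [if_neg hk.2, zero_mul]
  rw [hzero, add_zero]
  have hset : (range (n + 1)).filter (fun k => i < k) = Ico (i + 1) (n + 1) := by
    ext k; simp only [mem_filter, mem_range, mem_Ico]; omega
  rw [hset]
  exact sum_congr rfl fun k hk => by rw [if_pos (by have := (mem_Ico.mp hk).1; omega)]

/-- The Harnack load of the older ages with indicator weights is the `θ`-weighted sum of their lone reads (drops). [folklore] -/
theorem older_load_eq (hRL : ∀ i v m, RL i v m = ∑ l ∈ range N, KL i m l * v (m + 1 + l)) {i : ℕ} (v : ℕ → ℝ) (m Y : ℕ) :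
    ∑ k ∈ range (n + 1), θ k m Y * ∑ l ∈ range N, (if i < k then KL k m l else 0) * v (m + 1 + l) =
      ∑ k ∈ Ioc i n, θ k m Y * RL k v m := by
  rw [← sum_filter_add_sum_filter_not (range (n + 1)) (fun k => i < k)]
  have hzero : ∑ k ∈ (range (n + 1)).filter (fun k => ¬ i < k),
      θ k m Y * ∑ l ∈ range N, (if i < k then KL k m l else 0) * v (m + 1 + l) = 0 :=
    sum_eq_zero fun k hk => by
      rw [mem_filter] at hk
      have : ∑ l ∈ range N, (if i < k then KL k m l else 0) * v (m + 1 + l) = 0 :=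
        sum_eq_zero fun l _ => by rw [if_neg hk.2, zero_mul]
      rw [this, mul_zero]
  rw [hzero, add_zero]
  have hset : (range (n + 1)).filter (fun k => i < k) = Ioc i n := by
    ext k; simp only [mem_filter, mem_range, mem_Ioc]; omega
  rw [hset]
  refine sum_congr rfl fun k hk => ?_
  rw [hRL]
  congr 1
  exact sum_congr rfl fun l _ => by rw [if_pos (mem_Ioc.mp hk).1]

/-- The old mass inside the young window with indicator weights is `Ω_i(m) = Σ_{k ∈ (i,n]} Σ_{l < y_i} KL k m l` (`y_i ≤ N`). [folklore] -/
theorem older_window_mass_eq {i : ℕ} (hyN : y i ≤ N) (m : ℕ) :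
    ∑ k ∈ range (n + 1), ∑ l ∈ (range N).filter (· < y i), (if i < k then KL k m l else 0) =
      ∑ k ∈ Ioc i n, ∑ l ∈ range (y i), KL k m l := by
  have hfl : (range N).filter (· < y i) = range (y i) := by
    ext l; simp only [mem_filter, mem_range]; omega
  rw [hfl, ← sum_filter_add_sum_filter_not (range (n + 1)) (fun k => i < k)]
  have hzero : ∑ k ∈ (range (n + 1)).filter (fun k => ¬ i < k), ∑ l ∈ range (y i), (if i < k then KL k m l else 0) = 0 :=
    sum_eq_zero fun k hk => sum_eq_zero fun l _ => by rw [mem_filter] at hk; rw [if_neg hk.2]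
  rw [hzero, add_zero]
  have hset : (range (n + 1)).filter (fun k => i < k) = Ioc i n := by
    ext k; simp only [mem_filter, mem_range, mem_Ioc]; omega
  rw [hset]
  exact sum_congr rfl fun k hk => sum_congr rfl fun l _ => by rw [if_pos (mem_Ioc.mp hk).1]

/-! ## §2 KEY WITH A RATIO at one pin, from the drop ratios of the older ages (the chain's step read as a Harnack bound) -/

/-- **KEY WITH THE CHAIN'S RATIO.**  Level `i` (young age `i`, window `y_i ≤ N`, lone kernels `KL ≥ 0` supported in lags `< y_·` and `< N`); `v ≥ 0` the
surplus of the OLDER ages for a non-increasing input `w` (`v = w − RA (i+1) v`); persistence of the lone kernels under pin shifts with defects `θ ≥ 0`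
non-decreasing in the lag.  At the pin `m`: if the drops of the older ages are bounded by carried ratios, `RL k v m ≤ β_k·v m` (`β_k ≥ 0`, `i < k ≤ n`),
and the window mass `Ω = Σ_{k∈(i,n]}Σ_{l<y_i}KL k m l < 1`, then with `V = Σ_{k∈(i,n]} θ k m y_i·β_k` and `x̃ = Σ_l KL i m l`:
(a) the window Harnack bound `(1 − Ω)·v(m+l) ≤ (1 + V)·v m` for `1 ≤ l ≤ y_i`; (b) **`RL i v m ≤ ρ·v m` with `ρ = x̃(1+V)∕(1−Ω)`** — the static
chain's ratio IS the KEY ratio.  ((E71c) `window_max_le` on the indicator-weighted older system.) [folklore] -/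
theorem key_ratio_of_drop_ratios
    (hKL : ∀ i m l, 0 ≤ KL i m l) (hKLN : ∀ i m l, N ≤ l → KL i m l = 0) (hKLy : ∀ i m l, y i ≤ l → KL i m l = 0)
    (hRL : ∀ i v m, RL i v m = ∑ l ∈ range N, KL i m l * v (m + 1 + l))
    (hRA : ∀ i v m, RA i v m = ∑ l ∈ range N, KA i m l * v (m + 1 + l))
    (hKA : ∀ i m l, KA i m l = KL i m l + KA (i + 1) m l) (hKAtop : ∀ m l, KA (n + 1) m l = 0)
    (hθ0 : ∀ k m l, 0 ≤ θ k m l) (hpers : ∀ k m l i', (1 - θ k m l) * KL k m (i' + l) ≤ KL k (m + l) i')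
    (hθmono : ∀ k m l l', l ≤ l' → θ k m l ≤ θ k m l')
    {i : ℕ} (hin : i ≤ n) (hy1 : 1 ≤ y i) (hyN : y i ≤ N)
    {v w : ℕ → ℝ} (hv0 : ∀ m, 0 ≤ v m) (hw : ∀ m, w (m + 1) ≤ w m) (heq : ∀ m, v m = w m - RA (i + 1) v m)
    {m : ℕ} {β : ℕ → ℝ} (hdrop : ∀ k, i < k → k ≤ n → RL k v m ≤ β k * v m)
    (hΩ1 : ∑ k ∈ Ioc i n, ∑ l ∈ range (y i), KL k m l < 1) :
    (∀ l, 1 ≤ l → l ≤ y i → (1 - ∑ k ∈ Ioc i n, ∑ l ∈ range (y i), KL k m l) * v (m + l) ≤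
        (1 + ∑ k ∈ Ioc i n, θ k m (y i) * β k) * v m) ∧
      RL i v m ≤ (∑ l ∈ range N, KL i m l) * (1 + ∑ k ∈ Ioc i n, θ k m (y i) * β k) /
        (1 - ∑ k ∈ Ioc i n, ∑ l ∈ range (y i), KL k m l) * v m := by
  -- the maximum of `v` over the window `m+1 … m+y_i`
  obtain ⟨l₀, hl₀mem, hl₀max⟩ := exists_max_image (Icc 1 (y i)) (fun l => v (m + l)) ⟨1, by simp [hy1]⟩
  set Vmax := v (m + l₀) with hVmax
  have hl₀ : 1 ≤ l₀ ∧ l₀ ≤ y i := by simpa [mem_Icc] using hl₀mem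
  have hVle : ∀ l, 1 ≤ l → l ≤ y i → v (m + l) ≤ Vmax := fun l h1 h2 => hl₀max l (by simp [mem_Icc, h1, h2])
  -- (E71c) `window_max_le` for the indicator-weighted older system
  have heq' : ∀ m', v m' = w m' - ∑ k ∈ range (n + 1), ∑ l ∈ range N, (if i < k then KL k m' l else 0) * v (m' + 1 + l) :=
    fun m' => by rw [heq m', older_read_eq hRA hKA hKAtop hin v m']
  have hwin := window_max_le (E := fun k m' l => if i < k then KL k m' l else 0) (θ := θ) (A := n + 1) (y := y i)
    (fun k m' l => by split_ifs; exacts [hKL k m' l, le_rfl])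
    (fun k m' l hl => by split_ifs; exacts [hKLN k m' l hl, rfl])
    hθ0 hv0 hw heq'
    (fun k _ l _ _ i' => by
      split_ifs
      · exact hpers k m l i'
      · simp)
    (fun k l _ hl => hθmono k m l (y i) hl) hVle ⟨l₀, hl₀.1, hl₀.2, rfl⟩
  rw [older_window_mass_eq (KL := KL) hyN, older_load_eq (θ := θ) hRL] at hwin
  set Ω := ∑ k ∈ Ioc i n, ∑ l ∈ range (y i), KL k m l with hΩ
  set V := ∑ k ∈ Ioc i n, θ k m (y i) * β k with hV
  -- the Harnack load is below `V · v m`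
  have hS : ∑ k ∈ Ioc i n, θ k m (y i) * RL k v m ≤ V * v m := by
    rw [hV, sum_mul]
    exact sum_le_sum fun k hk =>
      by have hk' := mem_Ioc.mp hk
         calc θ k m (y i) * RL k v m ≤ θ k m (y i) * (β k * v m) := mul_le_mul_of_nonneg_left (hdrop k hk'.1 hk'.2) (hθ0 k m _)
           _ = θ k m (y i) * β k * v m := by ring
  have hmax : (1 - Ω) * Vmax ≤ (1 + V) * v m := by nlinarith [hwin, hS]
  have hΩpos : 0 < 1 - Ω := by linarith
  constructor
  · intro l h1 h2
    calc (1 - Ω) * v (m + l) ≤ (1 - Ω) * Vmax := mul_le_mul_of_nonneg_left (hVle l h1 h2) hΩpos.le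
      _ ≤ (1 + V) * v m := hmax
  · -- young read ≤ x̃ · Vmax ≤ x̃ (1+V)/(1−Ω) · v m
    have hx0 : 0 ≤ ∑ l ∈ range N, KL i m l := sum_nonneg fun l _ => hKL i m l
    have hread : RL i v m ≤ (∑ l ∈ range N, KL i m l) * Vmax := by
      rw [hRL, sum_mul]
      exact sum_le_sum fun l _ => by
        by_cases hly : l < y i
        · have : v (m + 1 + l) ≤ Vmax := by
            have := hVle (1 + l) (by omega) (by omega); rwa [← add_assoc] at this
          exact mul_le_mul_of_nonneg_left this (hKL i m l)
        · rw [hKLy i m l (not_lt.mp hly)]; simp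
    have hVmax : Vmax ≤ (1 + V) / (1 - Ω) * v m := by
      rw [div_mul_eq_mul_div, le_div_iff₀ hΩpos]; linarith
    calc RL i v m ≤ (∑ l ∈ range N, KL i m l) * Vmax := hread
      _ ≤ (∑ l ∈ range N, KL i m l) * ((1 + V) / (1 - Ω) * v m) := mul_le_mul_of_nonneg_left hVmax hx0
      _ = (∑ l ∈ range N, KL i m l) * (1 + V) / (1 - Ω) * v m := by ring

/-! ## §3 THE JOINT INDUCTION OVER THE AGES: positivity AND drop ratios, driven by the static chain -/

section Induction

/-- Common hypotheses of the induction, read: ages `1 … n` young to old with NON-NEGATIVE lone kernels `KL i` (window `y_i`: `KL i m l = 0` for `l ≥ y_i`,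
and `l ≥ N`), aggregates `KA i = KL i + KA (i+1)` (`KA (n+1) = 0`), reads `RL`, `RA`, zero-tailed solution operators `SL`, `SA` ((E71b)); persistence
defects `θ ≥ 0`, non-decreasing in the lag, with `(1 − θ k m l)·KL k m (i'+l) ≤ KL k (m+l) i'` ((E75a) `persistence`∕`defect_mono` for the flow); THE
STATIC CHAIN AT EVERY PIN `m`, ages processed `n, n−1, …, 1`: `ρ_i(m) = x̃_i(m)(1 + Σ_{k∈(i,n]}θ k m y_i·β_{i+1}(m,k))∕(1 − Ω_i(m))`, `β_i(m,i) =
ρ_i(m)∕(1−ρ_i(m))`, `β_i(m,k) = β_{i+1}(m,k)∕(1−ρ_i(m))` (`k > i`), which CLOSES (`ρ_i(m) < 1`, `Ω_i(m) < 1` — (E80c) for the flow); MONO_i ((E71b)) and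
MONO′_i (the age-`i` drops of the full surplus of the ages `≥ i` are non-increasing in the pin).  **CONCLUSION, for every `i ≤ n+1` and every non-negative
non-increasing zero-tailed input `w`: the carried ratios are `≥ 0`, the surplus `SA i w` of the ages `≥ i` is NON-NEGATIVE, and at every pin `m` the drop
of every age `k ∈ [i,n]` is at most `β_i(m,k)` times the surplus: `RL k (SA i w) m ≤ β_i(m,k)·(SA i w) m`.**  Downward induction on `i`: KEY_i WITH THE
RATIO `ρ_i(m)` from §2 and the drop bounds of level `i+1`; positivity by (E71a) `nonneg_of_age_composition_antitone`; the sandwich `(1−ρ_i(m))·v ≤ ε ≤ v`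
by (E71d) `surplus_sandwich` (MONO′_i); transport of the ratios by (E71d) `drop_ratio_step` (older ages: monotonicity of the read; the young age: its KEY
ratio). [folklore] -/
theorem nonneg_and_drop_ratio_all_ages
    (hKL : ∀ i m l, 0 ≤ KL i m l) (hKLN : ∀ i m l, N ≤ l → KL i m l = 0) (hKLy : ∀ i m l, y i ≤ l → KL i m l = 0)
    (hRL : ∀ i v m, RL i v m = ∑ l ∈ range N, KL i m l * v (m + 1 + l))
    (hRA : ∀ i v m, RA i v m = ∑ l ∈ range N, KA i m l * v (m + 1 + l))
    (hKA : ∀ i m l, KA i m l = KL i m l + KA (i + 1) m l) (hKAtop : ∀ m l, KA (n + 1) m l = 0)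
    (hSL : ∀ i (w : ℕ → ℝ), (∀ m, N < m → w m = 0) → (∀ m, N < m → SL i w m = 0) ∧ ∀ m, SL i w m = w m - RL i (SL i w) m)
    (hSA : ∀ i (w : ℕ → ℝ), (∀ m, N < m → w m = 0) → (∀ m, N < m → SA i w m = 0) ∧ ∀ m, SA i w m = w m - RA i (SA i w) m)
    (hy : ∀ i, 1 ≤ i → i ≤ n → 1 ≤ y i ∧ y i ≤ N)
    (hθ0 : ∀ k m l, 0 ≤ θ k m l) (hpers : ∀ k m l i', (1 - θ k m l) * KL k m (i' + l) ≤ KL k (m + l) i')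
    (hθmono : ∀ k m l l', l ≤ l' → θ k m l ≤ θ k m l')
    {ρ : ℕ → ℕ → ℝ} {β : ℕ → ℕ → ℕ → ℝ}
    (hρ : ∀ i m, 1 ≤ i → i ≤ n → ρ i m = (∑ l ∈ range N, KL i m l) * (1 + ∑ k ∈ Ioc i n, θ k m (y i) * β (i + 1) m k) /
      (1 - ∑ k ∈ Ioc i n, ∑ l ∈ range (y i), KL k m l))
    (hβnew : ∀ i m, 1 ≤ i → i ≤ n → β i m i = ρ i m / (1 - ρ i m))
    (hβold : ∀ i m k, 1 ≤ i → i < k → k ≤ n → β i m k = β (i + 1) m k / (1 - ρ i m))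
    (hΩ1 : ∀ i m, 1 ≤ i → i ≤ n → ∑ k ∈ Ioc i n, ∑ l ∈ range (y i), KL k m l < 1)
    (hclose : ∀ i m, 1 ≤ i → i ≤ n → ρ i m < 1)
    (hMONO : ∀ i, 1 ≤ i → i ≤ n → ∀ w : ℕ → ℝ, (∀ m, 0 ≤ w m) → (∀ m, w (m + 1) ≤ w m) → (∀ m, N < m → w m = 0) →
      (∀ m, 0 ≤ RA (i + 1) (RL i (SL i (SA (i + 1) w))) m) ∧
      (∀ m, RA (i + 1) (RL i (SL i (SA (i + 1) w))) (m + 1) ≤ RA (i + 1) (RL i (SL i (SA (i + 1) w))) m))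
    (hMONO' : ∀ i, 1 ≤ i → i ≤ n → ∀ w : ℕ → ℝ, (∀ m, 0 ≤ w m) → (∀ m, w (m + 1) ≤ w m) → (∀ m, N < m → w m = 0) →
      ∀ m, RL i (SA i w) (m + 1) ≤ RL i (SA i w) m) :
    ∀ i, 1 ≤ i → i ≤ n + 1 →
      (∀ m k, i ≤ k → k ≤ n → 0 ≤ β i m k) ∧
      ∀ w : ℕ → ℝ, (∀ m, 0 ≤ w m) → (∀ m, w (m + 1) ≤ w m) → (∀ m, N < m → w m = 0) →
        (∀ m, 0 ≤ SA i w m) ∧ (∀ m k, i ≤ k → k ≤ n → RL k (SA i w) m ≤ β i m k * SA i w m) := by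
  suffices h : ∀ d i, i + d = n + 1 → 1 ≤ i →
      (∀ m k, i ≤ k → k ≤ n → 0 ≤ β i m k) ∧
      ∀ w : ℕ → ℝ, (∀ m, 0 ≤ w m) → (∀ m, w (m + 1) ≤ w m) → (∀ m, N < m → w m = 0) →
        (∀ m, 0 ≤ SA i w m) ∧ (∀ m k, i ≤ k → k ≤ n → RL k (SA i w) m ≤ β i m k * SA i w m) from
    fun i hi hin => h (n + 1 - i) i (by omega) hi
  intro d
  induction d with
  | zero =>
    intro i hi _
    have : i = n + 1 := by omega
    subst this
    refine ⟨fun m k hk hkn => by omega, fun w hw0 _ hwt => ⟨fun m => ?_, fun m k hk hkn => by omega⟩⟩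
    rw [aggregate_sol_top hRA hKAtop hSA hwt m]; exact hw0 m
  | succ d ih =>
    intro i hi hi1
    have hin : i ≤ n := by omega
    obtain ⟨hBN, hIH⟩ := ih (i + 1) (by omega) (by omega)
    obtain ⟨hy1, hyN⟩ := hy i hi1 hin
    -- the chain at every pin: signs
    have hx0 : ∀ m, 0 ≤ ∑ l ∈ range N, KL i m l := fun m => sum_nonneg fun l _ => hKL i m l
    have hV0 : ∀ m, 0 ≤ ∑ k ∈ Ioc i n, θ k m (y i) * β (i + 1) m k := fun m =>
      sum_nonneg fun k hk => mul_nonneg (hθ0 k m _) (hBN m k (by have := (mem_Ioc.mp hk).1; omega) (mem_Ioc.mp hk).2)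
    have hρ0 : ∀ m, 0 ≤ ρ i m := fun m => by
      rw [hρ i m hi1 hin]
      exact div_nonneg (mul_nonneg (hx0 m) (by linarith [hV0 m])) (by linarith [hΩ1 i m hi1 hin])
    have hρ1 : ∀ m, ρ i m < 1 := fun m => hclose i m hi1 hin
    -- (A) KEY_i WITH THE RATIO ρ_i(m), for every admissible input of the older system
    have hkey : ∀ w : ℕ → ℝ, (∀ m, 0 ≤ w m) → (∀ m, w (m + 1) ≤ w m) → (∀ m, N < m → w m = 0) →
        ∀ m, RL i (SA (i + 1) w) m ≤ ρ i m * SA (i + 1) w m := by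
      intro w hw0 hwa hwt m
      obtain ⟨hP, hDR⟩ := hIH w hw0 hwa hwt
      have h := (key_ratio_of_drop_ratios hKL hKLN hKLy hRL hRA hKA hKAtop hθ0 hpers hθmono hin hy1 hyN hP hwa
        (fun m' => (hSA (i + 1) w hwt).2 m') (m := m) (β := fun k => β (i + 1) m k)
        (fun k hk hkn => hDR m k (by omega) hkn) (hΩ1 i m hi1 hin)).2
      rw [hρ i m hi1 hin]
      exact h
    have hKEY : ∀ w : ℕ → ℝ, (∀ m, 0 ≤ w m) → (∀ m, w (m + 1) ≤ w m) → (∀ m, N < m → w m = 0) →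
        ∀ m, RL i (SA (i + 1) w) m ≤ SA (i + 1) w m := by
      intro w hw0 hwa hwt m
      have h1 := hkey w hw0 hwa hwt m
      have h2 := (hIH w hw0 hwa hwt).1 m
      nlinarith [hρ1 m]
    refine ⟨?_, ?_⟩
    · -- (D) the carried ratios stay non-negative
      intro m k hk hkn
      rcases Nat.lt_or_ge i k with hik | hik
      · rw [hβold i m k hi1 hik hkn]
        exact div_nonneg (hBN m k (by omega) hkn) (by linarith [hρ1 m])
      · have : k = i := by omega
        subst this
        rw [hβnew k m hi1 hin]
        exact div_nonneg (hρ0 m) (by linarith [hρ1 m])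
    · intro e he0 hea het
      -- (B) the full system at level `i` = old (ages ≥ i+1) + young (age i); positivity and the sandwich
      have hεrec : ∀ m, SA i e m = e m - RA (i + 1) (SA i e) m - RL i (SA i e) m := fun m => by
        rw [(hSA i e het).2 m, aggregate_read_succ hRL hRA hKA]; ring
      have hcomp := nonneg_of_age_composition_antitone (RO := RA (i + 1)) (Ry := RL i) (SO := SA (i + 1)) (Sy := SL i)
        (hRA (i + 1)) (hRL i) (hKL i) (hSA (i + 1)) (hSL i)
        (fun u hu0 hua hut => ⟨(hIH u hu0 hua hut).1, hKEY u hu0 hua hut, hMONO i hi1 hin u hu0 hua hut⟩)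
        he0 hea het (hSA i e het).1 hεrec
      have hε0 : ∀ m, 0 ≤ SA i e m := fun m => (hcomp m).1
      have hsand := surplus_sandwich (RO := RA (i + 1)) (Ry := RL i) (SO := SA (i + 1)) (Sy := SL i)
        (A := fun w => (∀ m, 0 ≤ w m) ∧ ∀ m, w (m + 1) ≤ w m)
        (hRA (i + 1)) (hRL i) (hKL i) (hSA (i + 1)) (hSL i) het ⟨he0, hea⟩
        (fun u hu hut => ⟨(hIH u hu.1 hu.2 hut).1, hKEY u hu.1 hu.2 hut, hMONO i hi1 hin u hu.1 hu.2 hut⟩)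
        (hSA i e het).1 hεrec (ρ := ρ i) (hkey e he0 hea het)
        ⟨fun m => read_nonneg (hRL i) (hKL i) (fun m' _ => hε0 m') , hMONO' i hi1 hin e he0 hea het⟩
      obtain ⟨_, hDRv⟩ := hIH e he0 hea het
      refine ⟨hε0, fun m k hk hkn => ?_⟩
      -- (C) transport of the drop ratios
      have hle : ∀ m', SA i e m' ≤ SA (i + 1) e m' := fun m' => (hsand m').2
      have hlow : (1 - ρ i m) * SA (i + 1) e m ≤ SA i e m := (hsand m).1
      rcases Nat.lt_or_ge i k with hik | hik
      · -- an older age: monotonicity of its read, its ratio at level i+1, divided by 1 − ρ_i(m)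
        rw [hβold i m k hi1 hik hkn]
        exact drop_ratio_step (D := fun u => RL k u m)
          (fun u u' hu0 huu' => read_le_read (hRL k) (hKL k) fun m' _ => huu' m')
          hε0 hle hlow (hρ1 m) (hBN m k (by omega) hkn) (hDRv m k (by omega) hkn)
      · -- the young age itself: its KEY ratio
        have : k = i := by omega
        subst this
        rw [hβnew k m hi1 hin]
        exact drop_ratio_step (D := fun u => RL k u m)
          (fun u u' hu0 huu' => read_le_read (hRL k) (hKL k) fun m' _ => huu' m')
          hε0 hle hlow (hρ1 m) (hρ0 m) (hkey e he0 hea het m)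

/-- **ROUTE (N), FIRST ORDER, END — MODULO MONO∕MONO′: THE STATIC CHAIN'S CLOSURE AT EVERY PIN GIVES THE COMPARISON.**  Under the hypotheses of
`nonneg_and_drop_ratio_all_ages` (in particular: the static chain closes at every pin — for the flow's first-order objects this is (E80c)
`flow_static_chain_closes_at_pin` — and MONO_i, MONO′_i at every age), the solution `ε` of the full first-order triangular system `ε = e − RA 1 ε` with a
non-negative non-increasing zero-tailed excess `e` is NON-NEGATIVE at every depth: the first-order STEP (E58′) for the finite profile.  ((E71b)
`nonneg_of_key_mono` with KEY_i now DERIVED from the chain instead of assumed.) [folklore] -/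
theorem nonneg_of_chain_closes
    (hKL : ∀ i m l, 0 ≤ KL i m l) (hKLN : ∀ i m l, N ≤ l → KL i m l = 0) (hKLy : ∀ i m l, y i ≤ l → KL i m l = 0)
    (hRL : ∀ i v m, RL i v m = ∑ l ∈ range N, KL i m l * v (m + 1 + l))
    (hRA : ∀ i v m, RA i v m = ∑ l ∈ range N, KA i m l * v (m + 1 + l))
    (hKA : ∀ i m l, KA i m l = KL i m l + KA (i + 1) m l) (hKAtop : ∀ m l, KA (n + 1) m l = 0)
    (hSL : ∀ i (w : ℕ → ℝ), (∀ m, N < m → w m = 0) → (∀ m, N < m → SL i w m = 0) ∧ ∀ m, SL i w m = w m - RL i (SL i w) m)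
    (hSA : ∀ i (w : ℕ → ℝ), (∀ m, N < m → w m = 0) → (∀ m, N < m → SA i w m = 0) ∧ ∀ m, SA i w m = w m - RA i (SA i w) m)
    (hy : ∀ i, 1 ≤ i → i ≤ n → 1 ≤ y i ∧ y i ≤ N)
    (hθ0 : ∀ k m l, 0 ≤ θ k m l) (hpers : ∀ k m l i', (1 - θ k m l) * KL k m (i' + l) ≤ KL k (m + l) i')
    (hθmono : ∀ k m l l', l ≤ l' → θ k m l ≤ θ k m l')
    {ρ : ℕ → ℕ → ℝ} {β : ℕ → ℕ → ℕ → ℝ}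
    (hρ : ∀ i m, 1 ≤ i → i ≤ n → ρ i m = (∑ l ∈ range N, KL i m l) * (1 + ∑ k ∈ Ioc i n, θ k m (y i) * β (i + 1) m k) /
      (1 - ∑ k ∈ Ioc i n, ∑ l ∈ range (y i), KL k m l))
    (hβnew : ∀ i m, 1 ≤ i → i ≤ n → β i m i = ρ i m / (1 - ρ i m))
    (hβold : ∀ i m k, 1 ≤ i → i < k → k ≤ n → β i m k = β (i + 1) m k / (1 - ρ i m))
    (hΩ1 : ∀ i m, 1 ≤ i → i ≤ n → ∑ k ∈ Ioc i n, ∑ l ∈ range (y i), KL k m l < 1)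
    (hclose : ∀ i m, 1 ≤ i → i ≤ n → ρ i m < 1)
    (hMONO : ∀ i, 1 ≤ i → i ≤ n → ∀ w : ℕ → ℝ, (∀ m, 0 ≤ w m) → (∀ m, w (m + 1) ≤ w m) → (∀ m, N < m → w m = 0) →
      (∀ m, 0 ≤ RA (i + 1) (RL i (SL i (SA (i + 1) w))) m) ∧
      (∀ m, RA (i + 1) (RL i (SL i (SA (i + 1) w))) (m + 1) ≤ RA (i + 1) (RL i (SL i (SA (i + 1) w))) m))
    (hMONO' : ∀ i, 1 ≤ i → i ≤ n → ∀ w : ℕ → ℝ, (∀ m, 0 ≤ w m) → (∀ m, w (m + 1) ≤ w m) → (∀ m, N < m → w m = 0) →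
      ∀ m, RL i (SA i w) (m + 1) ≤ RL i (SA i w) m)
    {e ε : ℕ → ℝ} (he0 : ∀ m, 0 ≤ e m) (hea : ∀ m, e (m + 1) ≤ e m) (het : ∀ m, N < m → e m = 0)
    (hεt : ∀ m, N < m → ε m = 0) (hεrec : ∀ m, ε m = e m - RA 1 ε m) : ∀ m, 0 ≤ ε m := by
  rcases Nat.eq_zero_or_pos n with hn0 | hn0
  · -- no age at all: `RA 1 = 0`
    subst hn0
    intro m
    rw [hεrec m, hRA, sum_eq_zero fun l _ => by rw [hKAtop, zero_mul]]
    linarith [he0 m]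
  have h := (nonneg_and_drop_ratio_all_ages hKL hKLN hKLy hRL hRA hKA hKAtop hSL hSA hy hθ0 hpers hθmono hρ hβnew hβold hΩ1 hclose
    hMONO hMONO' 1 le_rfl (by omega)).2 e he0 hea het
  have heq : ∀ m, ε m = SA 1 e m := sol_unique (hRA 1) hεt hεrec (hSA 1 e het).1 (hSA 1 e het).2
  exact fun m => (heq m).symm ▸ h.1 m

end Induction

end Summit.QuantumFields.BalabanUV.Beta.EriceRemainderEnclosureHistoryAutonomyComparisonAgeCompositionChainWiring

end
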